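import Mathlib
import HarnessLib
import Summits.KontsevichZagierPeriods.KontsevichZagierPeriods.Theses.HurwitzMicroSectors
import Literature.NumberTheory.Transcendental.BoxCoordinatePowerMap
import Literature.NumberTheory.Transcendental.BoxIntegralHurwitz
import Literature.NumberTheory.Transcendental.KZProductIdeal
import Literature.NumberTheory.Transcendental.SemialgebraicMapsProofs

/-!
# Sketch — crux AperySectorThreeTwo (stmt-KontsevichZagierPeriods-3873), crux-ideate round 1, ideator 2

First lemmas of the three idea cards, typed over existing declarations:

* shared bookkeeping (PROVED): `diffRep`, `value_diffRep`, `equivalent_iff_of_mem_relations` — pass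
  from the two-representation form to the KERNEL FORM on the difference representation;
* card `dilation-coinvariants`: `ProductDilation` (engine, generic `n`), `MonomialCompression`
  (the new relation `tᵏ ∼ (k+1)⁻³` by the `(k+1)`-th power map applied to a constant),
  `DistributionTwo`, the pure-algebra `CoinvariantCertificate`, the transfer `SectorKernelThreeTwo`
  and the PROVED reduction `aperySectorThreeTwo_of_kernel : SectorKernelThreeTwo → crux`;
* card `level-lowering`: `LevelOneSector`, `LevelOneReduction`, `LevelTwoToLevelOne` and the PROVED
  composition `aperySectorThreeTwo_of_levelOne`;
* card `tensor-cube-lift`: `IntervalMonomial` (the 1-dim seed), `box_succ_eq_prodDomain` (PROVED: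
  the box is a product domain), `TensorCubeLift`.
-/

noncomputable section

open MeasureTheory Set
open Literature.NumberTheory.Transcendental

namespace Summit.KontsevichZagierPeriods.KontsevichZagierPeriods.Cruxes.AperySectorThreeTwo.IdeatorTwo

/-- The open unit box of `Fin n → ℝ` (literal shape of the route items). -/
abbrev box (n : ℕ) : Set (Fin n → ℝ) := {x | ∀ i, x i ∈ Set.Ioo (0:ℝ) 1}

/-! ## Shared bookkeeping: the difference representation and the kernel form -/

/-- The difference representation `[σ, f − f']` of two representations on a common domain. -/
def diffRep {n : ℕ} (r r' : KZ.IntegralRep n) (h : r'.domain = r.domain) : KZ.IntegralRep n where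
  domain := r.domain
  integrand := r.integrand - r'.integrand
  isSemialgebraic_domain := r.isSemialgebraic_domain
  isSemialgebraicFunOn_integrand :=
    IsSemialgebraicFunOn.sub_holds r.isSemialgebraicFunOn_integrand
      (by rw [← h]; exact r'.isSemialgebraicFunOn_integrand)
  integrableOn := r.integrableOn.sub (by rw [← h]; exact r'.integrableOn)

theorem diffRep_domain {n : ℕ} (r r' : KZ.IntegralRep n) (h : r'.domain = r.domain) :
    (diffRep r r' h).domain = r.domain := rfl

theorem diffRep_integrand {n : ℕ} (r r' : KZ.IntegralRep n) (h : r'.domain = r.domain) :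
    (diffRep r r' h).integrand = r.integrand - r'.integrand := rfl

/-- `value [σ, f − f'] = value [σ, f] − value [σ, f']`. -/
theorem value_diffRep {n : ℕ} (r r' : KZ.IntegralRep n) (h : r'.domain = r.domain) :
    (diffRep r r' h).value = r.value - r'.value := by
  have h' : r'.value = ∫ x in r.domain, r'.integrand x := by rw [KZ.IntegralRep.value, h]
  rw [h', KZ.IntegralRep.value, KZ.IntegralRep.value]
  show ∫ x in r.domain, (r.integrand - r'.integrand) x = _
  simp only [Pi.sub_apply]
  exact integral_sub r.integrableOn (by rw [← h]; exact r'.integrableOn)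

/-- **Kernel form.** If `d` has the domain of `r`, `r'` and `f = f' + f_d` on it, then
`r ∼ r'` iff `[d] ∈ relations` (one integrand-additivity move). -/
theorem equivalent_iff_of_mem_relations {n : ℕ} (r r' d : KZ.IntegralRep n)
    (h₁ : r'.domain = r.domain) (h₂ : d.domain = r.domain)
    (h₃ : EqOn r.integrand (r'.integrand + d.integrand) r.domain) :
    KZ.Equivalent r r' ↔ KZ.of d ∈ KZ.relations := by
  have hadd : KZ.of r - KZ.of r' - KZ.of d ∈ KZ.relations :=
    KZ.integrandAddRel_subset_relations ⟨n, r, r', d, h₁, h₂, h₃, rfl⟩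
  constructor
  · intro h
    have e : KZ.of d = (KZ.of r - KZ.of r') - (KZ.of r - KZ.of r' - KZ.of d) := by abel
    rw [e]
    exact KZ.relations.sub_mem h hadd
  · intro hd
    have e : KZ.of r - KZ.of r' = (KZ.of r - KZ.of r' - KZ.of d) + KZ.of d := by abel
    show KZ.of r - KZ.of r' ∈ KZ.relations
    rw [e]
    exact KZ.relations.add_mem hadd hd

/-! ## Card `dilation-coinvariants` -/

/-- **Engine (generic `n`, `m ≥ 1`).** Pulling back a function of the product `t = ∏ xᵢ` along
the coordinatewise power map `Φₘ = BoxIntegral.coordPow m` (Jacobian `mⁿ ∏ xᵢ^{m−1}`,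
`BoxIntegral.abs_det_coordPowDeriv`; `Φₘ '' box = box`, `BoxIntegral.image_coordPow_box`;
injective, `BoxIntegral.injOn_coordPow_box`) is ONE change-of-variables move. The restriction of
`HurwitzMicroSectors.DilationMove` to integrands `g (∏ xᵢ)`; the only field not yet in tree is
`IsSemialgebraicMapOn ℚ (box n) (coordPow m)` (`isSemialgebraicMapOn_aeval` with `X i ^ m`). -/
def ProductDilation (n : ℕ) : Prop :=
  ∀ (m : ℕ), 1 ≤ m → ∀ (g : ℝ → ℝ) (r r' : KZ.IntegralRep n),
    r.domain = box n → r'.domain = box n →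
    EqOn r'.integrand (fun x => g (∏ i, x i)) r'.domain →
    EqOn r.integrand (fun x => (m : ℝ) ^ n * (∏ i, x i) ^ (m - 1) * g ((∏ i, x i) ^ m)) r.domain →
    KZ.of r - KZ.of r' ∈ KZ.changeOfVariablesRel

/-- **The new relation: monomial compression.** `[c·(xyz)ᵏ] ∼ [c/(k+1)³]` on the open box — ONE
move: `ProductDilation 3` with `m = k + 1` applied to the CONSTANT `g = c/(k+1)³`
(`(k+1)³ tᵏ · c/(k+1)³ = c tᵏ`). No Newton–Leibniz, no change of dimension. -/
def MonomialCompression : Prop :=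
  ∀ (k : ℕ) (c : ℚ) (r r' : KZ.IntegralRep 3), r.domain = box 3 → r'.domain = box 3 →
    EqOn r.integrand (fun x => (c : ℝ) * (x 0 * x 1 * x 2) ^ k) r.domain →
    EqOn r'.integrand (fun _ => (c : ℝ) / ((k : ℝ) + 1) ^ 3) r'.domain →
    KZ.Equivalent r r'

/-- **The level-`2` distribution relation as one move**: `[8b·t/(1−t²)] ∼ [b/(1−t)]`, `t = xyz`
(`ProductDilation 3` with `m = 2`, `g = b/(1−t)`): `H₀ + H₁ ∼ 8H₁`. -/
def DistributionTwo : Prop :=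
  ∀ (b : ℚ) (r r' : KZ.IntegralRep 3), r.domain = box 3 → r'.domain = box 3 →
    EqOn r.integrand (fun x => 8 * (b : ℝ) * (x 0 * x 1 * x 2) / (1 - (x 0 * x 1 * x 2) ^ 2)) r.domain →
    EqOn r'.integrand (fun x => (b : ℝ) / (1 - x 0 * x 1 * x 2)) r'.domain →
    KZ.Equivalent r r'

/-- The "box value" functional of a polynomial: `Σₖ qₖ/(k+1)³ = ∫_{(0,1)³} Q(xyz)`. -/
def boxval (Q : Polynomial ℚ) : ℚ := Q.sum fun k q => q / ((k : ℚ) + 1) ^ 3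

/-- **Coinvariant certificate (pure algebra in `ℚ[X]`, decidable instance by instance).** Every
numerator decomposes as normal form `a(1 − X²) + bX` plus coboundaries of the dilation monoid:
`(1 − X²)(Q − boxval Q)` (killed by `MonomialCompression` + integrand additivity) and
`α(1 − 7X)` (killed by `DistributionTwo`). Solution: `P = Q'(1 − X²) + α' + β'X` (division),
`Q = Q'`, `a = boxval Q'`, `b = β' + 7α'`, `α = α'`. -/
def CoinvariantCertificate : Prop :=
  ∀ P : Polynomial ℚ, ∃ (a b α : ℚ) (Q : Polynomial ℚ),
    P = Polynomial.C a * (1 - Polynomial.X ^ 2) + Polynomial.C b * Polynomial.X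
        + (1 - Polynomial.X ^ 2) * (Q - Polynomial.C (boxval Q))
        + Polynomial.C α * (1 - 7 * Polynomial.X)

/-- **Transfer C⁺ (kernel form of the crux on the sector).** A sector representation of value `0`
is a relation. -/
def SectorKernelThreeTwo : Prop :=
  ∀ (d : KZ.IntegralRep 3) (P : Polynomial ℚ), d.domain = box 3 →
    EqOn d.integrand
      (fun x => Polynomial.aeval (x 0 * x 1 * x 2) P / (1 - (x 0 * x 1 * x 2) ^ 2)) d.domain →
    d.value = 0 → KZ.of d ∈ KZ.relations

/-- **C⁺ ⇒ crux** (proved): the difference of two sector reps is a sector rep (numerator `P − P'`)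
of value `r.value − r'.value = 0`. -/
theorem aperySectorThreeTwo_of_kernel (h : SectorKernelThreeTwo) :
    Theses.HurwitzMicroSectors.AperySectorThreeTwo := by
  intro r r' P P' hr hr' hf hf' hv
  have hdom : r'.domain = r.domain := by rw [hr, hr']
  refine (equivalent_iff_of_mem_relations r r' (diffRep r r' hdom) hdom rfl ?_).2
    (h (diffRep r r' hdom) (P - P') hr ?_ ?_)
  · intro x _
    simp [diffRep_integrand]
  · intro x hx
    have hx' : x ∈ r'.domain := hdom ▸ hx
    simp only [diffRep_integrand, Pi.sub_apply, hf hx, hf' hx', map_sub]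
    ring
  · rw [value_diffRep, hv, sub_self]

/-! ### The engine and the two relations, PROVED (evidence that the lever is one move each) -/

/-- `ProductDilation n` holds: the coordinatewise power map packaged as ONE `changeOfVariablesRel`
instance (all analytic fields from `BoxCoordinatePowerMap.lean`; semialgebraicity from
`isSemialgebraicMapOn_aeval` with the monomials `X j ^ m`). -/
theorem productDilation_holds (n : ℕ) : ProductDilation n := by
  intro m hm g r r' hr hr' hg hf
  have hm0 : m ≠ 0 := by omega
  have hbox : Literature.ModelTheory.ExponentialFields.IsSemialgebraic ℚ (box n) :=
    hr ▸ r.isSemialgebraic_domain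
  refine ⟨n, r, r', BoxIntegral.coordPow m, BoxIntegral.coordPowDeriv m, ?_, ?_, ?_, ?_, ?_, rfl⟩
  · rw [hr]
    refine (isSemialgebraicMapOn_aeval hbox (fun j => (MvPolynomial.X j) ^ m)).congr ?_
    intro x _
    funext j
    simp [BoxIntegral.coordPow]
  · intro x _
    exact BoxIntegral.hasFDerivWithinAt_coordPow m _ x
  · rw [hr]
    exact BoxIntegral.injOn_coordPow_box hm0
  · rw [hr, hr', BoxIntegral.image_coordPow_box hm0]
  · intro x hx
    have hxb : ∀ i, x i ∈ Set.Ioo (0:ℝ) 1 := by rw [hr] at hx; exact hx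
    have hΦ : BoxIntegral.coordPow m x ∈ r'.domain := by
      rw [hr']
      exact BoxIntegral.mapsTo_coordPow_box hm0 hxb
    rw [hf hx, hg hΦ, BoxIntegral.abs_det_coordPowDeriv hm0 hxb]
    simp only [BoxIntegral.coordPow_apply, Finset.prod_pow]
    ring

/-- `MonomialCompression` holds: ONE move, `Φ_{k+1}` applied to the constant `c/(k+1)³`. -/
theorem monomialCompression_holds : MonomialCompression := by
  intro k c r r' hr hr' hf hf'
  have h := productDilation_holds 3 (k + 1) (by omega) (fun _ => (c : ℝ) / ((k : ℝ) + 1) ^ 3)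
    r r' hr hr' (fun x hx => by simpa using hf' hx) ?_
  · exact KZ.changeOfVariablesRel_subset_relations h
  · intro x hx
    rw [hf hx]
    simp only [Fin.prod_univ_three, Nat.add_sub_cancel]
    push_cast
    field_simp

/-- `DistributionTwo` holds: ONE move, `Φ₂` applied to `b/(1 − t)`. -/
theorem distributionTwo_holds : DistributionTwo := by
  intro b r r' hr hr' hf hf'
  have h := productDilation_holds 3 2 (by omega) (fun t => (b : ℝ) / (1 - t))
    r r' hr hr' (fun x hx => by simpa [Fin.prod_univ_three] using hf' hx) ?_
  · exact KZ.changeOfVariablesRel_subset_relations h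
  · intro x hx
    rw [hf hx]
    simp only [Fin.prod_univ_three]
    have hx' : ∀ i, x i ∈ Set.Ioo (0:ℝ) 1 := by rw [hr] at hx; exact hx
    have h0 := hx' 0
    have h1 := hx' 1
    have h2 := hx' 2
    have h01 : x 0 * x 1 < 1 := by nlinarith [h0.1, h0.2, h1.1, h1.2]
    have ht : x 0 * x 1 * x 2 < 1 := by nlinarith [h01, h2.1, h2.2, mul_pos h0.1 h1.1]
    have htpos : 0 < x 0 * x 1 * x 2 := mul_pos (mul_pos h0.1 h1.1) h2.1
    have hne : (1 : ℝ) - (x 0 * x 1 * x 2) ^ 2 ≠ 0 := by nlinarith [ht, htpos]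
    have hne' : (1 : ℝ) - x 0 * x 1 * x 2 ≠ 0 := by linarith
    have hfac : (1 : ℝ) - (x 0 * x 1 * x 2) ^ 2 = (1 - x 0 * x 1 * x 2) * (1 + x 0 * x 1 * x 2) := by ring
    rw [hfac]
    field_simp
    ring

/-! ## Card `level-lowering` -/

/-- **C⁺, first half: Conjecture 1 on the LEVEL-1 weight-3 box sector** `P(xyz)/(1 − xyz)`
(Kontsevich–Zagier's own example family; values `a + P(1)·ζ(3)`), UNCONDITIONAL by Apéry. -/
def LevelOneSector : Prop :=
  ∀ (r r' : KZ.IntegralRep 3) (P P' : Polynomial ℚ), r.domain = box 3 → r'.domain = box 3 →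
    EqOn r.integrand (fun x => Polynomial.aeval (x 0 * x 1 * x 2) P / (1 - x 0 * x 1 * x 2)) r.domain →
    EqOn r'.integrand (fun x => Polynomial.aeval (x 0 * x 1 * x 2) P' / (1 - x 0 * x 1 * x 2)) r'.domain →
    r.value = r'.value → KZ.Equivalent r r'

/-- **Level-1 reduction: the residue at the pole is the only transcendental coordinate.**
`[P(t)/(1−t)] ∼ [a + P(1)/(1−t)]` with `a = −boxval Q₁ ∈ ℚ`, `P(t) − P(1) = (t − 1)Q₁(t)`
(integrand additivity + `MonomialCompression` on `−Q₁`; no distribution relation at level 1). -/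
def LevelOneReduction : Prop :=
  ∀ (r : KZ.IntegralRep 3) (P : Polynomial ℚ), r.domain = box 3 →
    EqOn r.integrand (fun x => Polynomial.aeval (x 0 * x 1 * x 2) P / (1 - x 0 * x 1 * x 2)) r.domain →
    ∃ (a : ℚ) (N : KZ.IntegralRep 3), N.domain = box 3 ∧
      EqOn N.integrand (fun x => (a : ℝ) + ((Polynomial.eval 1 P : ℚ) : ℝ) / (1 - x 0 * x 1 * x 2))
        N.domain ∧
      KZ.Equivalent r N

/-- **C⁺, second half: level 2 = level 1 + Φ₂^*(level 1).** With `P = α + βX + (1 − X²)Q`: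
`P/(1−t²) = A(t)/(1−t) + 8b·t/(1−t²)`, `A = α + (1 − X)Q`, `b = (β − α)/8`, and ONE dilation
(`DistributionTwo`) turns the second summand into `b/(1−t)`: every level-2 rep is equivalent to the
level-1 rep with numerator `P₁ = A + b`. -/
def LevelTwoToLevelOne : Prop :=
  ∀ (r : KZ.IntegralRep 3) (P : Polynomial ℚ), r.domain = box 3 →
    EqOn r.integrand
      (fun x => Polynomial.aeval (x 0 * x 1 * x 2) P / (1 - (x 0 * x 1 * x 2) ^ 2)) r.domain →
    ∃ (P₁ : Polynomial ℚ) (r₁ : KZ.IntegralRep 3), r₁.domain = box 3 ∧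
      EqOn r₁.integrand
        (fun x => Polynomial.aeval (x 0 * x 1 * x 2) P₁ / (1 - x 0 * x 1 * x 2)) r₁.domain ∧
      KZ.Equivalent r r₁

/-- **C⁺ ⇒ crux** (proved: soundness `KZ.Equivalent.value_eq_holds` + transitivity). -/
theorem aperySectorThreeTwo_of_levelOne (h₁ : LevelTwoToLevelOne) (h₂ : LevelOneSector) :
    Theses.HurwitzMicroSectors.AperySectorThreeTwo := by
  intro r r' P P' hr hr' hf hf' hv
  obtain ⟨P₁, r₁, hd₁, hf₁, e₁⟩ := h₁ r P hr hf
  obtain ⟨P₁', r₁', hd₁', hf₁', e₁'⟩ := h₁ r' P' hr' hf'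
  have hv₁ : r₁.value = r₁'.value := by
    rw [← KZ.Equivalent.value_eq_holds e₁, ← KZ.Equivalent.value_eq_holds e₁', hv]
  exact (e₁.trans (h₂ r₁ r₁' P₁ P₁' hd₁ hd₁' hf₁ hf₁' hv₁)).trans e₁'.symm

/-! ## Card `tensor-cube-lift` -/

/-- **The one-variable seed**: `[c·xᵏ]₍₀,₁₎ ∼ [c/(k+1)]₍₀,₁₎` (one Newton–Leibniz move over the
base `Fin 0` with the polynomial primitive `c x^{k+1}/(k+1)` and the null faces, or one 1-dim power
map `x ↦ x^{k+1}`). -/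
def IntervalMonomial : Prop :=
  ∀ (k : ℕ) (c : ℚ) (r r' : KZ.IntegralRep 1), r.domain = box 1 → r'.domain = box 1 →
    EqOn r.integrand (fun x => (c : ℝ) * x 0 ^ k) r.domain →
    EqOn r'.integrand (fun _ => (c : ℝ) / ((k : ℝ) + 1)) r'.domain →
    KZ.Equivalent r r'

/-- **The box is a product domain** (the bookkeeping the tensor line pays once):
`box (n + 1) = box n × box 1` in the convention of `KZ.IntegralRep.prodDomain` (`Fin.castAdd` /
`Fin.natAdd`). Proved. -/
theorem box_succ_eq_prodDomain (n : ℕ) (r : KZ.IntegralRep n) (s : KZ.IntegralRep 1)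
    (hr : r.domain = box n) (hs : s.domain = box 1) :
    KZ.IntegralRep.prodDomain r s = box (n + 1) := by
  ext z
  simp only [KZ.IntegralRep.mem_prodDomain, hr, hs, Set.mem_setOf_eq]
  constructor
  · rintro ⟨h1, h2⟩ i
    exact Fin.addCases (motive := fun i => z i ∈ Set.Ioo (0:ℝ) 1) (fun i => h1 i) (fun j => h2 j) i
  · intro h
    exact ⟨fun i => h _, fun j => h _⟩

/-- **Tensor-cube lift** (the card's thesis for the polynomial half of the crux): the seed cubes to
`MonomialCompression` through the PROVED ideal property of `KZ.relations`
(`KZ.Equivalent.prod`, `KZ.mul_sub_mul_mem_relations`, `KZ.IntegralRep.value_prod`) and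
`box_succ_eq_prodDomain`; no Jacobian in dimension `3` is ever computed for the polynomial part. -/
def TensorCubeLift : Prop := IntervalMonomial → MonomialCompression

/-! ## Sanity: the tree facts every card leans on (names checked to exist) -/

example : (2 : ℕ) ≤ 3 := by norm_num
#check @BoxIntegral.setIntegral_box_eq_setIntegral_comp_pow
#check @BoxIntegral.image_coordPow_box
#check @BoxIntegral.abs_det_coordPowDeriv
#check @BoxIntegral.box_integral_normalForm_weight_three
#check @BoxIntegral.normalForm_weight_three_coeff_eq
#check @BoxIntegral.level_two_weight_three_relation
#check @box_integral_one_div_one_sub_mul_three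
#check @BoxIntegral.integrableOn_box_prod_pow_div_one_sub_prod_pow
#check @KZ.Equivalent.prod
#check @KZ.Equivalent.value_eq_holds
#check @isSemialgebraicMapOn_aeval
#check @Theses.HurwitzMicroSectors.DilationMove

end Summit.KontsevichZagierPeriods.KontsevichZagierPeriods.Cruxes.AperySectorThreeTwo.IdeatorTwo
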